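import Summits.PneNP.PneNP.Theses.PhaseTwins
import Literature.Computability.Complexity.HardcoreInapproximability
import Literature.Computability.Complexity.FPRASTransfer
import Literature.Computability.Complexity.FPStringBricks
import Literature.Computability.Complexity.StockmeyerMachines
import Literature.Computability.Complexity.OracleCompositionMachine
import Literature.Computability.Complexity.OracleProofs
import Literature.Computability.Complexity.OracleEmptyFP
import Literature.Computability.Complexity.StructuralPHProofs
import Literature.Barriers.PneNP.Relativization

/-!
# Disproof of `NoFBPPApproxAboveUniqueness` — findings (cdisprove, gen 1, `refuter-cdisprove-stmt-PneNP-2717-0`)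

Work file of the standing adversary on crux `stmt-PneNP-2717`
(`Summit.PneNP.PneNP.Theses.PhaseTwins.NoFBPPApproxAboveUniqueness` = thesis X of route PhaseTwins,
rank 0, kind auto-crux / conjecture-grade). Prose lives in docstrings; every `theorem` is kernel-checked
(this file: 0 sorries).

Index
* §0 verdict and WHY IT RESISTS (`resists`).
* §1 DICTIONARY (kernel-checked): the crux is, verbatim up to `Iff.rfl`, "some admissible `(Δ, p, q)` has
  no PADDED FPRAS for `hardcoreCount Δ p q`" (`crux_iff`), and the padding slot `1^{r|x|}` of `countQuery`
  is removable in `FP` (`hasFPRAS_of_hasFPRASPadded`, a brick-algebra construction, no machine written),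
  so `¬ crux ↔ ∀ Δ ≥ 3, q > 0, p/q > λ_c(Δ): HasFPRAS (hardcoreCount Δ p q)` (`not_crux_iff`): a disproof
  of the crux is EXACTLY a uniform family of FPRASes for the hard-core partition function above the
  tree-uniqueness threshold at every degree bound.
* §2 the SANDWICH, kernel-checked modulo the tree's vendored GŠV16 Thm 1
  (`NP_eq_RP_of_hardcoreFPRAS`, a named fact, unproved in the tree): `¬ crux → NP = RP`
  (`NP_eq_RP_of_not_crux`) and `NP ≠ RP → crux` (`crux_of_NP_ne_RP`); the upper half `crux → P ≠ NP`
  is the route's Assembly (item stmt-PneNP-2718, Stockmeyer, proved bridges) and is not repeated here.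
* §3 load-bearing analysis: the ONLY hypothesis of the inner non-existence claim is the time bound —
  `crux_false_without_FP` (exact counting as an unbounded transducer); the witness side conditions:
  `0 < q` is REDUNDANT (`q_pos_of_threshold_lt`), `3 ≤ Δ` only keeps the threshold formula meaningful
  (§4) and dropping it WEAKENS the (existential) crux, so it is not load-bearing for truth; the guards
  `0 < kη`, `0 < kδ` are format (`isApproxCount_zero_iff`, `failure_bound_at_kδ_zero`): dropping them
  weakens the crux to an exact-counting lower bound.
* §4 threshold sanity and degenerate parameters (`threshold_values`, junk below `Δ = 3`, least integer
  witnesses).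
* §5 natural strengthenings and neighbouring regimes that ARE false but not formalisable now
  (`strengthenings`).
* §6 BARRIER REDUCTION, kernel-checked: the relativised crux `CruxRel O` (`FP ↦ FP^O`; `CruxRel ∅ ↔ crux`,
  `cruxRel_empty_iff`) is FALSE relative to every collapsing oracle `NP^O ⊆ P^O` given `#P`-membership of
  `hardcoreCount` (`cruxRel_false_of_collapse`: proved Stockmeyer `stockmeyerApproxCounting_holds` at `O` +
  proved oracle composition), hence — with the PROVED Baker–Gill–Solovay oracle `baker_gill_solovay_eq_holds`
  — `HardcoreCountSharpP → ¬ Relativizes CruxRel` (`not_relativizes_cruxRel`): modulo the route's own routine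
  support item stmt-PneNP-2722, NO RELATIVISING ARGUMENT PROVES THE CRUX. The barrier is ONE-SIDED:
  `X^O → X` for every `O` (`crux_of_cruxRel`, `FP ⊆ FP^O`), so a contrary world for `¬X` would prove X,
  and a disproof of X kills every `X^O` (`not_cruxRel_of_not_crux`).
* `-- Targets`: none yet (payload.targets / stuck_stubs empty at gen 1).

LANDED (p81782, commit ff8170762cc9): `Summits/PneNP/PneNP/Theorems/NoFBPPApproxAboveUniqueness/Negative/
FPRASDictionary.lean`, namespace `Summit.PneNP.PneNP.Theorems.NoFBPPApproxAboveUniqueness.Negative` — the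
theorems of §1–§3 and §6 with statements inlined (no defs): `hasFPRAS_of_padded`, `crux_iff_inline`,
`not_crux_iff`, `not_crux_of_hasFPRAS`, `NP_eq_RP_of_not_crux`, `crux_false_without_FP`,
`q_pos_of_threshold_lt`, `relCrux_false_of_collapse`, `not_relativizes_relCrux`, `crux_iff_relCrux_empty`,
`not_relCrux_of_not_crux`. Import that module (not this work file) from stubs / skeletons.
-/

set_option linter.dupNamespace false

namespace Summit.PneNP.PneNP.Cruxes.NoFBPPApproxAboveUniqueness.Disproof

open Literature.Computability.Complexity Literature.Probability.LatticeModels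
open _root_.Computability Polynomial
open Summit.PneNP.PneNP.Theses.PhaseTwins (NoFBPPApproxAboveUniqueness HardcoreCountSharpP)
open Literature.Barriers.PneNP (Relativizes)

/-! ## §0 Verdict -/

/-- **Verdict (gen 1, 2026-08-16): NO KILL; the crux resists because a disproof is an algorithmic
breakthrough of `NP ⊆ RP` strength.**

Read-back of the elaborated statement (probe rc 0): `∃ Δ p q : ℕ, 3 ≤ Δ ∧ 0 < q ∧ λ_c(Δ) < p/q ∧
¬ ∃ F ∈ FP, ∃ c r : ℕ[X], ∀ x kη kδ, 0 < kη → 0 < kδ → Pr_{u ∈ {0,1}^{c(|x|+r|x|+kη+kδ)}}[¬ (N x/(1+1/kη) ≤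
⟨F ⟨x,1^{r|x|},1^{kη},1^{kδ},u⟩⟩₂ ≤ (1+1/kη) N x)] ≤ 1/kδ` with `N = hardcoreCount Δ p q` VERBATIM
(`crux_iff` is `Iff.rfl`) and `λ_c = hardCoreThreshold` verbatim. Coercions: `p q kδ : ℕ → ℝ`; `1/kδ`
with `kδ ≥ 1` (no `1/0`); `Δ - 1` is ℕ-subtraction but harmless under `3 ≤ Δ`; the graph decoder
requires the adjacency field to have length EXACTLY `n²` (`encodingBitVec`), so `n ≤ √|x|` and no
exponentially padded junk instance exists; off the promise `N = 0` forces the estimate `0`, decidable in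
`FP`; `uniformProb` counts coin strings of the exact length. Quantifier order `∃ F c r ∀ x kη kδ` = a
uniform scheme (FPRAS with confidence parameter, AA13 Def. 2.4 format). Nothing mis-typed, nothing vacuous:
the inner success criterion is satisfiable (`isApproxCount_self`), and the inner body is literally the
`O = ∅` body of the PROVED `stockmeyerApproxCounting` with `countWitnesses ↦ N`.

Attacks tried (all fail for a structural reason, not for lack of search):
* junk / degenerate witnesses — none: every admissible `(Δ, p/q)` has `Δ ≥ 3`, `p/q > λ_c(Δ) > 0`
  (`q_pos_of_threshold_lt`), and for EVERY such pair GŠV16 Thm 1 says an FPRAS gives `NP = RP`;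
* cheap transducers — exact counting is `#P`-hard, trivial estimates (`q^n`, `(p+q)^n`) are off by
  `2^{Θ(n)}`; the failure bound must hold for all `kδ`, the factor for all `kη`;
* encoding leniency (exponential padding making brute force polynomial) — excluded, see above;
* finite models — the statement has no finite-model content (it quantifies over all of `FP`).

Consequently the negative side can only CALIBRATE: §1–§2 prove that `¬ crux` is equivalent to
"FPRAS above `λ_c` at every `Δ ≥ 3`" and hence (mod GŠV16) implies `NP = RP`, while the route's
Assembly gives `crux → P ≠ NP`. The crux is sandwiched `NP ≠ RP ⟹ X ⟹ P ≠ NP`; neither side is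
attackable with current mathematics, which is the honest meaning of "conjecture-grade". -/
theorem resists : True := trivial

/-! ## §1 Dictionary: the crux in the tree's FPRAS vocabulary -/

/-- **Padded FPRAS format**: the inner body of the crux for a general counting function `N` — an
`FP` transducer answering `⟨x, 1^{r|x|}, 1^{kη}, 1^{kδ}, u⟩` with coins of length `c(|x| + r|x| + kη + kδ)`.
`HasFPRAS N` (`FPRAS.lean`) is the case `r = 0`. -/
def HasFPRASPadded (N : List Bool → ℕ) : Prop :=
  ∃ F ∈ FP, ∃ c r : Polynomial ℕ, ∀ (x : List Bool) (kη kδ : ℕ), 0 < kη → 0 < kδ →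
    uniformProb (c.eval (x.length + r.eval x.length + kη + kδ))
      {u | ¬ IsApproxCount kη (N x) (countEstimate F x (r.eval x.length) kη kδ u)} ≤ 1 / (kδ : ℝ)

/-- **The crux, verbatim, in tree vocabulary** (`Iff.rfl`: the route inlines `hardCoreThreshold Δ` and
`hardcoreCount Δ p q` literally). -/
theorem crux_iff :
    NoFBPPApproxAboveUniqueness ↔
      ∃ Δ p q : ℕ, 3 ≤ Δ ∧ 0 < q ∧ hardCoreThreshold Δ < (p : ℝ) / q ∧
        ¬ HasFPRASPadded (hardcoreCount Δ p q) :=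
  Iff.rfl

/-- An FPRAS is a padded FPRAS (`r = 0`). -/
theorem hasFPRASPadded_of_hasFPRAS {N : List Bool → ℕ} (h : HasFPRAS N) : HasFPRASPadded N := by
  obtain ⟨F, hF, c, hc⟩ := h
  refine ⟨F, hF, c, 0, fun x kη kδ hkη hkδ => ?_⟩
  simpa using hc x kη kδ hkη hkδ

namespace PadRemoval

/-! ### Removing the padding slot in `FP` (brick algebra; no machine is written)

On the canonical query `w = ⟨⟨x, ⟨1⁰, ⟨1^{kη}, 1^{kδ}⟩⟩⟩, U⟩` the transformer `tF c r` rebuilds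
`⟨⟨x, ⟨1^{r|x|}, ⟨1^{kη}, 1^{kδ}⟩⟩⟩, U ↾ L⟩` with `L = c(|x| + r|x| + kη + kδ)`; composing the padded
transducer with it gives an unpadded one using a PREFIX of its coins. -/

variable (c r : Polynomial ℕ)

/-- `x` (first field of the first field). -/
noncomputable def xF : List Bool → List Bool := Brick.fstF ∘ Brick.fstF

/-- `⟨1^{kη}, 1^{kδ}⟩` (the record after the padding slot). -/
noncomputable def kkF : List Bool → List Bool := Brick.sndF ∘ Brick.sndF ∘ Brick.fstF

/-- `1^{r|x|}`. -/
noncomputable def mF : List Bool → List Bool := Plumb.polyFn r ∘ xF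

/-- `x 1^{r|x|} 1^{kη} 1^{kδ}`, a string of length `|x| + r|x| + kη + kδ`. -/
noncomputable def sF : List Bool → List Bool :=
  fun w => (xF w ++ mF r w) ++ (Brick.fstF (kkF w) ++ Brick.sndF (kkF w))

/-- The ruler `1^L`, `L = c(|x| + r|x| + kη + kδ)`. -/
noncomputable def rulerF : List Bool → List Bool := Plumb.polyFn c ∘ sF r

/-- The truncated coins `U ↾ L`. -/
noncomputable def uF : List Bool → List Bool := Plumb.takeFn ∘ fanoutFn (rulerF c r) Brick.sndF

/-- The query transformer. -/
noncomputable def tF : List Bool → List Bool :=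
  fanoutFn (fanoutFn xF (fanoutFn (mF r) kkF)) (uF c r)

theorem xF_mem_FP : xF ∈ FP := comp_mem_FP Brick.fstF_mem_FP Brick.fstF_mem_FP

theorem kkF_mem_FP : kkF ∈ FP :=
  comp_mem_FP Brick.sndF_mem_FP (comp_mem_FP Brick.sndF_mem_FP Brick.fstF_mem_FP)

theorem mF_mem_FP : mF r ∈ FP := comp_mem_FP (Plumb.polyFn_mem_FP r) xF_mem_FP

theorem sF_mem_FP : sF r ∈ FP :=
  append_mem_FP (append_mem_FP xF_mem_FP (mF_mem_FP r))
    (append_mem_FP (comp_mem_FP Brick.fstF_mem_FP kkF_mem_FP) (comp_mem_FP Brick.sndF_mem_FP kkF_mem_FP))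

theorem rulerF_mem_FP : rulerF c r ∈ FP := comp_mem_FP (Plumb.polyFn_mem_FP c) (sF_mem_FP r)

theorem uF_mem_FP : uF c r ∈ FP :=
  comp_mem_FP Plumb.takeFn_mem_FP (fanoutFn_mem_FP (rulerF_mem_FP c r) Brick.sndF_mem_FP)

/-- `tF c r ∈ FP`. -/
theorem tF_mem_FP : tF c r ∈ FP :=
  fanoutFn_mem_FP (fanoutFn_mem_FP xF_mem_FP (fanoutFn_mem_FP (mF_mem_FP r) kkF_mem_FP)) (uF_mem_FP c r)

/-- **Semantics of the transformer on canonical queries.** -/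
theorem tF_countQuery (x u : List Bool) (kη kδ : ℕ) :
    tF c r (countQuery x 0 kη kδ u) =
      countQuery x (r.eval x.length) kη kδ
        (u.take (c.eval (x.length + r.eval x.length + kη + kδ))) := by
  have hx : xF (countQuery x 0 kη kδ u) = x := by
    simp [xF, countQuery]
  have hkk : kkF (countQuery x 0 kη kδ u) = boolPair (unaryEncodeNat kη) (unaryEncodeNat kδ) := by
    simp [kkF, countQuery]
  have hm : mF r (countQuery x 0 kη kδ u) = unaryEncodeNat (r.eval x.length) := by
    simp [mF, hx, APTransfer.ones_eq_unary]
  have hs : (sF r (countQuery x 0 kη kδ u)).length = x.length + r.eval x.length + kη + kδ := by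
    simp [sF, hx, hm, hkk, APTransfer.length_unary]
    omega
  have hsnd : Brick.sndF (countQuery x 0 kη kδ u) = u := by
    simp [countQuery]
  have hu : uF c r (countQuery x 0 kη kδ u) =
      u.take (c.eval (x.length + r.eval x.length + kη + kδ)) := by
    simp only [uF, rulerF, Function.comp_apply, fanoutFn_apply, Plumb.polyFn_apply, hs, hsnd,
      Plumb.takeFn_boolPair, List.length_replicate]
  simp only [tF, fanoutFn_apply, hx, hm, hkk, hu]
  rfl

end PadRemoval

/-- **The padding slot is removable**: a padded FPRAS yields an FPRAS (same transducer precomposed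
with `tF c r`, coin budget `c ∘ (X + r)`, of which a prefix is used — `uniformProb_take_le_of_le`). -/
theorem hasFPRAS_of_hasFPRASPadded {N : List Bool → ℕ} (h : HasFPRASPadded N) : HasFPRAS N := by
  obtain ⟨F, hF, c, r, hP⟩ := h
  refine ⟨F ∘ PadRemoval.tF c r, comp_mem_FP hF (PadRemoval.tF_mem_FP c r), c.comp (X + r),
    fun x kη kδ hkη hkδ => ?_⟩
  set L := c.eval (x.length + r.eval x.length + kη + kδ) with hLdef
  have hL : L ≤ (c.comp (X + r)).eval (x.length + kη + kδ) := by
    simp only [eval_comp, eval_add, eval_X, hLdef]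
    apply TM2Iter.eval_mono
    have := TM2Iter.eval_mono r (show x.length ≤ x.length + kη + kδ by omega)
    omega
  have key : {U | ¬ IsApproxCount kη (N x) (countEstimate (F ∘ PadRemoval.tF c r) x 0 kη kδ U)} =
      {U | U.take L ∈ {u | ¬ IsApproxCount kη (N x) (countEstimate F x (r.eval x.length) kη kδ u)}} := by
    ext U
    simp only [Set.mem_setOf_eq, countEstimate_def, Function.comp_apply, PadRemoval.tF_countQuery, hLdef]
  rw [key]
  exact APTransfer.uniformProb_take_le_of_le hL _ (hP x kη kδ hkη hkδ)

/-- Padded and unpadded FPRAS are the same notion. -/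
theorem hasFPRASPadded_iff {N : List Bool → ℕ} : HasFPRASPadded N ↔ HasFPRAS N :=
  ⟨hasFPRAS_of_hasFPRASPadded, hasFPRASPadded_of_hasFPRAS⟩

/-- **The negation of the crux, exactly**: FPRASes for the hard-core partition function above the
uniqueness threshold at EVERY degree bound `Δ ≥ 3` and every rational activity. -/
theorem not_crux_iff :
    ¬ NoFBPPApproxAboveUniqueness ↔
      ∀ Δ p q : ℕ, 3 ≤ Δ → 0 < q → hardCoreThreshold Δ < (p : ℝ) / q → HasFPRAS (hardcoreCount Δ p q) := by
  rw [crux_iff]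
  simp only [not_exists, not_and, not_not, hasFPRASPadded_iff]

/-! ## §2 The sandwich (modulo the vendored GŠV16 Theorem 1) -/

/-- **WHY IT RESISTS, lower half**: modulo the named fact `NP_eq_RP_of_hardcoreFPRAS` (Galanis–
Štefankovič–Vigoda 2016 Thm 1, vendored in `HardcoreInapproximability.lean`, unproved in the tree),
ANY disproof of the crux proves `NP = RP`. (Instantiate the family of FPRASes at `Δ = 3`, `λ = 5 > 4`.) -/
theorem NP_eq_RP_of_not_crux (hGSV : NP_eq_RP_of_hardcoreFPRAS) (h : ¬ NoFBPPApproxAboveUniqueness) :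
    Nondeterministic.NP = RP := by
  rw [not_crux_iff] at h
  refine hGSV 3 5 1 le_rfl one_pos ?_ (h 3 5 1 le_rfl one_pos ?_) <;>
  · rw [hardCoreThreshold_three]; norm_num

/-- The same, read as a conditional proof of the crux (documentation of the sandwich; a positive
conditional statement, NOT a landing): `NP ≠ RP` and GŠV16 Thm 1 give the crux — at every admissible
witness, e.g. `(Δ, λ) = (3, 5)`. The upper half `crux → (HardcoreCountSharpP → P ≠ NP)` is the
route's Assembly (stmt-PneNP-2718). -/
theorem crux_of_NP_ne_RP (hGSV : NP_eq_RP_of_hardcoreFPRAS) (hne : Nondeterministic.NP ≠ RP) :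
    NoFBPPApproxAboveUniqueness := by
  by_contra h
  exact hne (NP_eq_RP_of_not_crux hGSV h)

/-! ## §3 Load-bearing analysis -/

/-- The crux with the hypothesis `F ∈ FP` DROPPED (any transducer `F : {0,1}* → {0,1}*`). -/
def NoFBPPApproxAboveUniquenessWithoutFP : Prop :=
  ∃ Δ p q : ℕ, 3 ≤ Δ ∧ 0 < q ∧ hardCoreThreshold Δ < (p : ℝ) / q ∧
    ¬ ∃ F : List Bool → List Bool, ∃ c r : Polynomial ℕ, ∀ (x : List Bool) (kη kδ : ℕ), 0 < kη → 0 < kδ →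
      uniformProb (c.eval (x.length + r.eval x.length + kη + kδ))
        {u | ¬ IsApproxCount kη (hardcoreCount Δ p q x) (countEstimate F x (r.eval x.length) kη kδ u)} ≤
          1 / (kδ : ℝ)

/-- **Any proof must use the time bound on `F` (and nothing else of the inner claim is load-bearing):**
without `F ∈ FP` the statement is false at EVERY witness — the exact counter
`F ⟨⟨x, …⟩, u⟩ = ⟨N x⟩₂` never errs (`isApproxCount_self`), with no coins and no padding. -/
theorem crux_false_without_FP : ¬ NoFBPPApproxAboveUniquenessWithoutFP := by
  rintro ⟨Δ, p, q, -, -, -, h⟩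
  apply h
  refine ⟨fun w => encodeNat (hardcoreCount Δ p q (boolUnpair (boolUnpair w).1).1), 0, 0,
    fun x kη kδ _ hkδ => ?_⟩
  have hval : ∀ u, countEstimate (fun w => encodeNat (hardcoreCount Δ p q (boolUnpair (boolUnpair w).1).1))
      x ((0 : Polynomial ℕ).eval x.length) kη kδ u = hardcoreCount Δ p q x := by
    intro u
    simp [countEstimate_def, countQuery, boolUnpair_boolPair, decode_encodeNat]
  have hempty : {u | ¬ IsApproxCount kη (hardcoreCount Δ p q x)
      (countEstimate (fun w => encodeNat (hardcoreCount Δ p q (boolUnpair (boolUnpair w).1).1))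
        x ((0 : Polynomial ℕ).eval x.length) kη kδ u)} = ∅ :=
    Set.eq_empty_iff_forall_notMem.2 fun u hu => hu (by rw [hval]; exact isApproxCount_self _ _)
  rw [hempty, uniformProb_empty]
  positivity

/-- **`0 < q` is redundant** in the witness conditions: for `Δ ≥ 3` the threshold is positive, and
`(p : ℝ) / 0 = 0`. (Information for the planner; harmless.) -/
theorem q_pos_of_threshold_lt {Δ p q : ℕ} (hΔ : 3 ≤ Δ) (h : hardCoreThreshold Δ < (p : ℝ) / q) : 0 < q := by
  rcases Nat.eq_zero_or_pos q with rfl | hq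
  · have := hardCoreThreshold_pos hΔ
    simp at h
    linarith
  · exact hq

/-- With `FP` kept but the witness conditions read off: the crux is equivalent to its `0 < q`-free form. -/
theorem crux_iff_without_qpos :
    NoFBPPApproxAboveUniqueness ↔
      ∃ Δ p q : ℕ, 3 ≤ Δ ∧ hardCoreThreshold Δ < (p : ℝ) / q ∧ ¬ HasFPRASPadded (hardcoreCount Δ p q) := by
  rw [crux_iff]
  constructor
  · rintro ⟨Δ, p, q, hΔ, -, hlam, h⟩
    exact ⟨Δ, p, q, hΔ, hlam, h⟩
  · rintro ⟨Δ, p, q, hΔ, hlam, h⟩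
    exact ⟨Δ, p, q, hΔ, q_pos_of_threshold_lt hΔ hlam, hlam, h⟩

/-- **The guards `0 < kη`, `0 < kδ` are format, not load-bearing.** At `kη = 0` the success criterion
degenerates to EXACT counting (`1/(0:ℝ) = 0`, factor `1 + 0`), and at `kδ = 0` the failure bound `1/0 = 0`
demands success on every coin string; dropping the guards therefore STRENGTHENS the inner existence claim
(an exact, never-erring polynomial-time counter) and WEAKENS the crux to an exact-counting lower bound for
`hardcoreCount` — still open (it is implied by `FP ≠ #P`-type hypotheses, and by X itself). -/
theorem isApproxCount_zero_iff (n N : ℕ) : IsApproxCount 0 n N ↔ N = n := by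
  unfold IsApproxCount
  simp only [Nat.cast_zero, div_zero, add_zero, div_one, one_mul, Nat.cast_le]
  omega

/-- At `kδ = 0` the bound `≤ 1/kδ = 0` forces the failure event to have probability exactly `0`. -/
theorem failure_bound_at_kδ_zero (m : ℕ) (E : Set (List Bool)) :
    uniformProb m E ≤ 1 / ((0 : ℕ) : ℝ) ↔ uniformProb m E = 0 := by
  simp only [Nat.cast_zero, div_zero]
  exact ⟨fun h => le_antisymm h (uniformProb_nonneg m E), fun h => h.le⟩

/-! ## §4 Threshold sanity and degenerate parameters -/

/-- **Threshold values.** `λ_c(3) = 4` (tree: `hardCoreThreshold_three`), `λ_c(4) = 27/16`,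
`λ_c(5) = 256/243 > 1`, `λ_c(6) = 3125/4096 < 1` (so `λ = 1`, i.e. counting independent sets, is above
threshold exactly from `Δ = 6` on — consistent with the known `Δ ≥ 6` hardness of #IS); and the JUNK
values below `Δ = 3`: `λ_c(2) = 1/0 = 0`, `λ_c(1) = 1/(-1) = -1`, `λ_c(0) = 1` (ℕ-subtraction and `x/0 = 0`).
So `3 ≤ Δ` is what keeps the side condition meaningful — without it `(Δ, λ) = (2, any λ > 0)` would be
admissible, where `Z` is computable exactly in polynomial time (paths and cycles, transfer matrices);
but since the crux is EXISTENTIAL in `Δ`, dropping `3 ≤ Δ` only weakens it: not load-bearing for truth. -/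
theorem threshold_values :
    hardCoreThreshold 3 = 4 ∧ hardCoreThreshold 4 = 27 / 16 ∧ hardCoreThreshold 5 = 256 / 243 ∧
      hardCoreThreshold 6 = 3125 / 4096 ∧
      hardCoreThreshold 2 = 0 ∧ hardCoreThreshold 1 = -1 ∧ hardCoreThreshold 0 = 1 := by
  refine ⟨hardCoreThreshold_three, ?_, ?_, ?_, ?_, ?_, ?_⟩ <;> norm_num [hardCoreThreshold]

/-- **Least integer witnesses.** At `Δ = 3` the activity `λ = 4` is NOT admissible (the inequality is
strict: `λ_c(3) = 4`), `λ = 5` is; at `Δ = 6` already `λ = 1` (plain #IS on max-degree-6 graphs) is,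
at `Δ = 5` it is not. -/
theorem least_witnesses :
    ¬ hardCoreThreshold 3 < ((4 : ℕ) : ℝ) / ((1 : ℕ) : ℝ) ∧ hardCoreThreshold 3 < ((5 : ℕ) : ℝ) / ((1 : ℕ) : ℝ) ∧
      hardCoreThreshold 6 < ((1 : ℕ) : ℝ) / ((1 : ℕ) : ℝ) ∧ ¬ hardCoreThreshold 5 < ((1 : ℕ) : ℝ) / ((1 : ℕ) : ℝ) := by
  refine ⟨?_, ?_, ?_, ?_⟩ <;> norm_num [hardCoreThreshold]

/-! ## §5 Strengthenings, neighbouring regimes, relativisation (prose) -/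

/-- **Natural strengthenings / neighbours that are FALSE but not refutable in Lean today** (each needs a
concrete `FP` membership proof of a real algorithm, i.e. a TM2-level construction far beyond the brick
algebra):
1. `∀ Δ ≥ 3 ∀ λ > 0` (threshold dropped): false for `λ < λ_c(Δ)` by Weitz 2006 (FPTAS via strong spatial
   mixing / self-avoiding-walk tree) and by Patel–Regts 2017 + Peters–Regts 2019 (zero-freeness +
   Barvinok interpolation); the route itself records this as `LogDepthContinuityBelow`.
2. `Δ ≤ 2` admitted (degree bound dropped, junk threshold `0`): graphs of max degree `≤ 2` are disjoint
   paths and cycles, `Z` is a product of `2×2` transfer-matrix traces — exact counting in `FP`.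
3. AT the threshold `λ = λ_c(Δ)` (`λ = 4` at `Δ = 3`; irrational in general): excluded by the strict
   inequality; complexity open in print (neither Weitz nor Sly applies) — correctly NOT claimed.
4. Universal form `∀ Δ ≥ 3 ∀ p/q > λ_c(Δ)` (GŠV16's full strength): still `NP ≠ RP`-conditional, not
   attackable either way; the existential form chosen by the planner is the WEAKEST statement that still
   feeds the Assembly, which is the right choice for a target.
**Relativisation**: see §6 (kernel-checked). -/
theorem strengthenings : True := trivial

/-! ## §6 Barrier reduction: the crux does not relativise (kernel-checked) -/

/-- **The relativised crux `X^O`**: the crux with `FP` replaced by `FP^O` (`FPRel O`), everything else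
verbatim (`hardcoreCount`, `hardCoreThreshold` are the route's inlined terms). -/
def CruxRel (O : Oracle) : Prop :=
  ∃ Δ p q : ℕ, 3 ≤ Δ ∧ 0 < q ∧ hardCoreThreshold Δ < (p : ℝ) / q ∧
    ¬ ∃ F ∈ FPRel O, ∃ c r : Polynomial ℕ, ∀ (x : List Bool) (kη kδ : ℕ), 0 < kη → 0 < kδ →
      uniformProb (c.eval (x.length + r.eval x.length + kη + kδ))
        {u | ¬ IsApproxCount kη (hardcoreCount Δ p q x) (countEstimate F x (r.eval x.length) kη kδ u)} ≤
          1 / (kδ : ℝ)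

/-- `X^∅ ↔ X` (`FPRel_empty_eq : FP^∅ = FP`, proved in the tree). -/
theorem cruxRel_empty_iff : CruxRel Oracle.empty ↔ NoFBPPApproxAboveUniqueness := by
  unfold CruxRel
  rw [FPRel_empty_eq]
  rfl

/-- **Relative to a collapsing oracle the crux fails**, given `#P`-membership of the counting function:
Stockmeyer's approximate counter (`stockmeyerApproxCounting_holds`, PROVED for every oracle) for the
witness relation `R ∈ P ⊆ P^O` runs in `FP^{L}` for some `L ∈ NP^O ⊆ P^O`, hence in `FP^O`
(`ofLanguage_mem_FPRel_of_mem_PRel`, `FPRel_subset_FPRel_of_mem_FPRel`, both proved), and its guarantee at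
`m := r(|x|)` is literally the negated inner body. -/
theorem cruxRel_false_of_collapse (hN : ∀ Δ p q : ℕ, hardcoreCount Δ p q ∈ SharpP) {O : Oracle}
    (hO : NPRel O ⊆ PRel O) : ¬ CruxRel O := by
  rintro ⟨Δ, p, q, -, -, -, h⟩
  obtain ⟨R, hR, rpoly, hcount⟩ := hN Δ p q
  obtain ⟨L, hL, F, hF, c, hc⟩ :=
    StockMachine.stockmeyerApproxCounting_holds O R (P_subset_PRel_holds O hR)
  have hFO : F ∈ FPRel O :=
    OracleAlg.FPRel_subset_FPRel_of_mem_FPRel (OracleAlg.ofLanguage_mem_FPRel_of_mem_PRel (hO hL)) hF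
  refine h ⟨F, hFO, c, rpoly, fun x kη kδ hkη hkδ => ?_⟩
  rw [hcount x]
  exact hc x (rpoly.eval x.length) kη kδ hkη hkδ

/-- The route's support item `HardcoreCountSharpP` (stmt-PneNP-2722) is, verbatim, `#P`-membership of
`hardcoreCount`. -/
theorem hardcoreCount_mem_sharpP_of (hN : HardcoreCountSharpP) (Δ p q : ℕ) :
    hardcoreCount Δ p q ∈ SharpP :=
  hN Δ p q

/-- **The crux does not relativise** (modulo the routine support item `HardcoreCountSharpP`): at the
PROVED Baker–Gill–Solovay collapsing oracle (`baker_gill_solovay_eq_holds`: `P^A = NP^A`) `X^A` fails. So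
every proof of X must use a non-relativising ingredient — the formal content of the route's concession that
`Literature.Barriers.PneNP.Relativization` "APPLIES to the target". -/
theorem not_relativizes_cruxRel (hN : HardcoreCountSharpP) : ¬ Relativizes CruxRel := by
  obtain ⟨A, -, hA⟩ := baker_gill_solovay_eq_holds
  intro h
  exact cruxRel_false_of_collapse (hardcoreCount_mem_sharpP_of hN) (O := Oracle.ofLanguage A)
    hA.symm.le (h A)

/-- The same as an explicit contrary world. -/
theorem exists_oracle_not_cruxRel (hN : HardcoreCountSharpP) :
    ∃ A : Language Bool, ¬ CruxRel (Oracle.ofLanguage A) := by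
  obtain ⟨A, -, hA⟩ := baker_gill_solovay_eq_holds
  exact ⟨A, cruxRel_false_of_collapse (hardcoreCount_mem_sharpP_of hN) hA.symm.le⟩

/-- **The relativised statements are STRONGER than the crux** (`FP ⊆ FP^O`, `FP_subset_FPRel_core`): so
a contrary world for `¬X` — an oracle `B` with `X^B` — would already PROVE `X`. The relativisation
barrier is ONE-SIDED for this target: it forbids relativising proofs of X (`not_relativizes_cruxRel`) and
says nothing against disproofs; conversely a disproof of X kills every `X^O` at once
(`not_cruxRel_of_not_crux`). (Positive conditional statement; documentation, not a landing.) -/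
theorem crux_of_cruxRel {O : Oracle} (h : CruxRel O) : NoFBPPApproxAboveUniqueness := by
  obtain ⟨Δ, p, q, hΔ, hq, hlam, hno⟩ := h
  exact ⟨Δ, p, q, hΔ, hq, hlam, fun ⟨F, hF, c, r, hP⟩ =>
    hno ⟨F, OracleAlg.FP_subset_FPRel_core O hF, c, r, hP⟩⟩

/-- A disproof of the crux disproves every relativised version. -/
theorem not_cruxRel_of_not_crux (h : ¬ NoFBPPApproxAboveUniqueness) (O : Oracle) : ¬ CruxRel O :=
  fun hO => h (crux_of_cruxRel hO)

end Summit.PneNP.PneNP.Cruxes.NoFBPPApproxAboveUniqueness.Disproof
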